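import Literature.NumberTheory.EllipticCurves.BhargavaShankarWeightProduct
import Literature.NumberTheory.EllipticCurves.BinaryQuarticClassOrbitCount
import HarnessLib

/-!
# The weights `m(f)` and the tree's `GL₂(ℤ)`-orbit counts: dictionary `V_ℤ ⊂ V_ℚ`, class
# invariance of `m`, and `Σ_O 1/m(O) ≤ #{PGL₂(ℚ)-classes} = Σ_O 1/n(O)`

`Proofs` companion (theorems only: no definitions, no named facts) of `BinaryQuarticOrbitWeights.lean`
(Bhargava–Shankar's weights `m(f) = globalWeight f`, defined through the twisted action of `GL₂(ℚ)` on
`V_ℚ` and the subgroup `ℚˣGL₂(ℤ)`), `BhargavaShankarWeightProduct.lean` (finiteness, `m(f) = #C(f)`)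
and `BinaryQuarticClassOrbitCount.lean` (the tree's count of `PGL₂(ℚ)`-classes through
`GL₂(ℤ)`-orbits: `pgl2QClassCount S = Σ_{O} 1/n(O)`).

Source: M. Bhargava, A. Shankar, *Binary quartic forms having bounded invariants, and the
boundedness of the average rank of elliptic curves*, Ann. of Math. (2) 181 (2015) 191–242, §3.2 of
the published version: "we must count `PGL₂(ℤ)`-orbits on `V_ℤ` where each orbit `PGL₂(ℤ)·f` is
weighted by `1/n(f)`, where `n(f)` is equal to the number of `PGL₂(ℤ)`-orbits inside the
`PGL₂(ℚ)`-equivalence class of `f` in `V_ℤ` … it suffices to instead weight each integral orbit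
`PGL₂(ℤ)·f` by `1/m(f)`", the two weightings agreeing except on the orbits with a nontrivial
stabiliser in `PGL₂(ℚ)` (negligible by Lemma 2.4). This file supplies the bookkeeping between the
two vocabularies:

* `image_gl2zOrbit_eq_orbit`: the image in `V_ℚ` of the `GL₂(ℤ)`-orbit of `f₀ ∈ V_ℤ`
  (`BinaryQuartic.gl2zOrbit`, substitution action) is the `ℚˣGL₂(ℤ)`-orbit of `f₀` for the twisted
  action; hence (`ncard_intClassOrbits_int`) the number of `ℚˣGL₂(ℤ)`-orbits in the `PGL₂(ℚ)`-class
  of `f₀` inside `V_ℤ` (`intClassOrbits`) **is `n(f₀)`**, the number of `GL₂(ℤ)`-orbits of integral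
  forms `PGL₂(ℚ)`-equivalent to `f₀`;
* `weight_smul`, `globalWeight_eq_of_pgl2Equiv`: **`m` is constant on `PGL₂(ℚ)`-classes**;
* `card_filter_orbitPGL2Equiv_eq_ncard_intClassOrbits`: for a set `S ⊆ V_ℤ` closed under
  `PGL₂(ℚ)`-equivalence, the denominators of `pgl2QClassCount_eq_sum_one_div` are the `n(f)`;
* `ncard_intClassOrbits_le_globalWeight` (`n(f) ≤ m(f)`, `Δ(f) ≠ 0`) and
  `sum_one_div_globalWeight_le_pgl2QClassCount`: **`Σ_{O} 1/m(O) ≤ #{PGL₂(ℚ)-classes met by S}`**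
  for such `S` (on which `Δ ≠ 0`), with equality when every form in `S` has all its
  `ℚ`-automorphisms in `PGL₂(ℤ)` (`sum_one_div_globalWeight_eq_pgl2QClassCount_of_stabilizer_le`) —
  the exact form of "it suffices to weight by `1/m(f)` instead of `1/n(f)`" before Lemma 2.4 is
  invoked.

## References

* M. Bhargava, A. Shankar, Ann. of Math. (2) 181 (2015) 191–242, §3.2 of the published version
  (= arXiv:1006.1002v3). [cite: BhargavaShankarAnnals2015, §3.2 (n(f), m(f); published numbering)]
-/

noncomputable section

open scoped Classical
open Matrix MulAction Literature.GroupTheory.Index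

namespace Literature.NumberTheory.EllipticCurves

namespace BinaryQuartic

/-! ## Class invariance of the weight -/

section General

variable {K : Type*} [Field K] {R : Type*} [CommRing R] (φ : R →+* K)

/-- The orbits entering the weight only depend on the `PGL₂(K)`-class: `B(g · f) "=" B(f)`. [folklore] -/
theorem intClassOrbits_smul (g : GL (Fin 2) K) (f : BinaryQuartic K) :
    intClassOrbits φ (g • f) = intClassOrbits φ f :=
  orbitsIn_smul g _

/-- **The weight is a class function**: `weight φ (g · f) = weight φ f` for every `g ∈ GL₂(K)`.
[cite: BhargavaShankarAnnals2015, §3.2 (m(f) depends only on the PGL₂(ℚ)-class; published numbering)] -/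
theorem weight_smul (g : GL (Fin 2) K) (f : BinaryQuartic K) : weight φ (g • f) = weight φ f := by
  rw [weight, weight, intClassOrbits_smul]

/-- The coset sets of `f` and `g · f` correspond by translation; in particular they have the same
size and are finite together. [folklore] -/
theorem ncard_cosets_smul (g : GL (Fin 2) K) (f : BinaryQuartic K) :
    (cosets φ (g • f)).ncard = (cosets φ f).ncard ∧ ((cosets φ (g • f)).Finite ↔ (cosets φ f).Finite) :=
  ⟨ncard_cosetsOver_smul g _, cosetsOver_smul_finite_iff g _⟩

end General

/-! ## The dictionary `V_ℤ ⊂ V_ℚ` -/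

/-- `V_ℤ → V_ℚ` is injective. [folklore] -/
theorem map_intCast_rat_injective : Function.Injective (BinaryQuartic.map (Int.castRingHom ℚ)) := by
  intro f g h
  have ha := congrArg BinaryQuartic.a h; have hb := congrArg BinaryQuartic.b h
  have hc := congrArg BinaryQuartic.c h; have hd := congrArg BinaryQuartic.d h
  have he := congrArg BinaryQuartic.e h
  simp only [map_a, map_b, map_c, map_d, map_e, eq_intCast, Int.cast_inj] at ha hb hc hd he
  ext <;> assumption

/-- For `γ ∈ GL₂(ℤ)` the twisted action of `γ` on the image of an integral form is the image of the
substitution action: `γ · f₀ = f₀((x,y)γ)` (as `det γ = ±1`). [folklore] -/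
theorem twist_map_intCast_of_isUnit_det {γ : Matrix (Fin 2) (Fin 2) ℤ} (hγ : IsUnit γ.det) (f₀ : BinaryQuartic ℤ) :
    twist (γ.map (Int.castRingHom ℚ)) (f₀.map (Int.castRingHom ℚ)) = (f₀.subst γ).map (Int.castRingHom ℚ) := by
  have hdet : γ.det * γ.det = 1 := by
    rcases Int.isUnit_iff.mp hγ with h | h <;> rw [h] <;> norm_num
  rw [twist_map_map_eq _ hdet]
  congr 1
  have : γ.det ^ 2 = 1 := by rw [sq, hdet]
  rw [this, one_smul]

/-- **The image in `V_ℚ` of the `GL₂(ℤ)`-orbit of `f₀` is the `ℚˣGL₂(ℤ)`-orbit of `f₀`** (twisted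
action). [folklore] -/
theorem image_gl2zOrbit_eq_orbit (f₀ : BinaryQuartic ℤ) :
    BinaryQuartic.map (Int.castRingHom ℚ) '' gl2zOrbit f₀ =
      orbit (integralUpToScalars (Int.castRingHom ℚ)) (f₀.map (Int.castRingHom ℚ)) := by
  ext F
  constructor
  · rintro ⟨g, ⟨γ, hγ, rfl⟩, rfl⟩
    have hγQ : (γ.map (Int.castRingHom ℚ)).det ≠ 0 := by
      rw [← RingHom.mapMatrix_apply, ← RingHom.map_det, eq_intCast, Int.cast_ne_zero]
      exact hγ.ne_zero
    refine mem_orbit_iff.mpr ⟨⟨Matrix.GeneralLinearGroup.mkOfDetNeZero _ hγQ,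
      mem_integralUpToScalars_of_eq_map _ hγ rfl⟩, ?_⟩
    rw [Subgroup.smul_def, gl_smul_def]
    exact twist_map_intCast_of_isUnit_det hγ f₀
  · rintro ⟨⟨G, c, k, hc, hk, hGk⟩, rfl⟩
    refine ⟨f₀.subst k, ⟨k, hk, rfl⟩, ?_⟩
    show (f₀.subst k).map (Int.castRingHom ℚ) = G • f₀.map (Int.castRingHom ℚ)
    rw [gl_smul_def, hGk, twist_smul hc]
    exact (twist_map_intCast_of_isUnit_det hk f₀).symm

/-- The integral forms in the `GL₂(ℚ)`-orbit of `f₀` are the images of the integral forms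
`PGL₂(ℚ)`-equivalent to `f₀`. [folklore] -/
theorem orbit_inter_integralForms_eq (f₀ : BinaryQuartic ℤ) :
    orbit (GL (Fin 2) ℚ) (f₀.map (Int.castRingHom ℚ)) ∩ integralForms (Int.castRingHom ℚ) =
      BinaryQuartic.map (Int.castRingHom ℚ) ''
        {g | PGL2Equiv (f₀.map (Int.castRingHom ℚ)) (g.map (Int.castRingHom ℚ))} := by
  ext F
  constructor
  · rintro ⟨hF, g, rfl⟩
    exact ⟨g, (mem_orbit_iff_pgl2Equiv _ _).mp hF, rfl⟩
  · rintro ⟨g, hg, rfl⟩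
    exact ⟨(mem_orbit_iff_pgl2Equiv _ _).mpr hg, map_mem_integralForms _ g⟩

/-- **`B(f₀)` in the two vocabularies**: the `ℚˣGL₂(ℤ)`-orbits in the class of `f₀` inside `V_ℤ`
are the images of the `GL₂(ℤ)`-orbits of the integral forms `PGL₂(ℚ)`-equivalent to `f₀`.
[cite: BhargavaShankarAnnals2015, §3.2 (B(f); published numbering)] -/
theorem intClassOrbits_int_eq (f₀ : BinaryQuartic ℤ) :
    intClassOrbits (Int.castRingHom ℚ) (f₀.map (Int.castRingHom ℚ)) =
      (fun O ↦ BinaryQuartic.map (Int.castRingHom ℚ) '' O) ''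
        (gl2zOrbit '' {g | PGL2Equiv (f₀.map (Int.castRingHom ℚ)) (g.map (Int.castRingHom ℚ))}) := by
  rw [intClassOrbits, orbitsIn, orbit_inter_integralForms_eq, Set.image_image, Set.image_image]
  refine Set.image_congr' fun g ↦ ?_
  exact (image_gl2zOrbit_eq_orbit g).symm

/-- **`#B(f₀) = n(f₀)`**: the number of `ℚˣGL₂(ℤ)`-orbits in the class of `f₀` inside `V_ℤ` is the
number of `GL₂(ℤ)`-orbits of integral forms `PGL₂(ℚ)`-equivalent to `f₀`.
[cite: BhargavaShankarAnnals2015, §3.2 (n(f); published numbering)] -/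
theorem ncard_intClassOrbits_int (f₀ : BinaryQuartic ℤ) :
    (intClassOrbits (Int.castRingHom ℚ) (f₀.map (Int.castRingHom ℚ))).ncard =
      (gl2zOrbit '' {g | PGL2Equiv (f₀.map (Int.castRingHom ℚ)) (g.map (Int.castRingHom ℚ))}).ncard := by
  rw [intClassOrbits_int_eq]
  exact Set.ncard_image_of_injective _ (Set.image_injective.mpr map_intCast_rat_injective)

/-- **`m` is constant on `PGL₂(ℚ)`-classes of integral forms.** [cite: BhargavaShankarAnnals2015, §3.2 (published numbering)] -/
theorem globalWeight_eq_of_pgl2Equiv {f g : BinaryQuartic ℤ}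
    (h : PGL2Equiv (f.map (Int.castRingHom ℚ)) (g.map (Int.castRingHom ℚ))) : globalWeight f = globalWeight g := by
  obtain ⟨G, hG⟩ := (mem_orbit_iff_pgl2Equiv _ _).mpr h
  change G • f.map (Int.castRingHom ℚ) = g.map (Int.castRingHom ℚ) at hG
  rw [globalWeight, globalWeight, ← hG, weight_smul]

/-- In particular `m` is constant on `GL₂(ℤ)`-orbits. [folklore] -/
theorem globalWeight_eq_of_mem_gl2zOrbit {f g : BinaryQuartic ℤ} (h : g ∈ gl2zOrbit f) :
    globalWeight g = globalWeight f :=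
  (globalWeight_eq_of_pgl2Equiv (pgl2Equiv_of_mem_gl2zOrbit h)).symm

/-- **`n(f) ≤ m(f)`** for `Δ(f) ≠ 0`. [cite: BhargavaShankarAnnals2015, §3.2 (published numbering)] -/
theorem ncard_intClassOrbits_le_globalWeight (f : BinaryQuartic ℤ) (hΔ : f.disc ≠ 0) :
    (gl2zOrbit '' {g | PGL2Equiv (f.map (Int.castRingHom ℚ)) (g.map (Int.castRingHom ℚ))}).ncard ≤
      globalWeight f := by
  rw [← ncard_intClassOrbits_int]
  exact ncard_intClassOrbits_le_weight _ _ (cosets_int_finite_and_ncard_eq f hΔ).1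

/-- `n(f) = m(f)` iff every integral form in the class of `f` has all its `ℚ`-automorphisms in
`PGL₂(ℤ)` (`Δ(f) ≠ 0`). [cite: BhargavaShankarAnnals2015, §3.2 (published numbering)] -/
theorem globalWeight_eq_ncard_iff (f : BinaryQuartic ℤ) (hΔ : f.disc ≠ 0) :
    globalWeight f =
      (gl2zOrbit '' {g | PGL2Equiv (f.map (Int.castRingHom ℚ)) (g.map (Int.castRingHom ℚ))}).ncard ↔
      ∀ g : BinaryQuartic ℤ, PGL2Equiv (f.map (Int.castRingHom ℚ)) (g.map (Int.castRingHom ℚ)) →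
        stabilizer (GL (Fin 2) ℚ) (g.map (Int.castRingHom ℚ)) ≤ integralUpToScalars (Int.castRingHom ℚ) := by
  rw [← ncard_intClassOrbits_int, globalWeight_eq_ncard_intClassOrbits_iff f hΔ, orbit_inter_integralForms_eq]
  constructor
  · intro h g hg
    exact h _ ⟨g, hg, rfl⟩
  · rintro h _ ⟨g, hg, rfl⟩
    exact h g hg

/-! ## The denominators of `pgl2QClassCount_eq_sum_one_div` -/

/-- For `S ⊆ V_ℤ` closed under `PGL₂(ℚ)`-equivalence and `f₀ ∈ S`, the `GL₂(ℤ)`-orbits met by `S` and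
`PGL₂(ℚ)`-related to `GL₂(ℤ)f₀` are the orbits of the integral forms equivalent to `f₀`; their number
is `n(f₀) = #B(f₀)`. [cite: BhargavaShankarAnnals2015, §3.2 (n(f); published numbering)] -/
theorem card_filter_orbitPGL2Equiv_eq_ncard_intClassOrbits (S : Set (BinaryQuartic ℤ))
    (hS : ∀ f ∈ S, ∀ g : BinaryQuartic ℤ,
      PGL2Equiv (f.map (Int.castRingHom ℚ)) (g.map (Int.castRingHom ℚ)) → g ∈ S)
    (hfin : (gl2zOrbit '' S).Finite) {f₀ : BinaryQuartic ℤ} (hf₀ : f₀ ∈ S) :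
    (hfin.toFinset.filter (fun O' ↦ OrbitPGL2Equiv O' (gl2zOrbit f₀))).card =
      (intClassOrbits (Int.castRingHom ℚ) (f₀.map (Int.castRingHom ℚ))).ncard := by
  rw [ncard_intClassOrbits_int, ← Set.ncard_coe_finset, Finset.coe_filter]
  congr 1
  ext O'
  simp only [Set.Finite.mem_toFinset, Set.mem_image, Set.mem_setOf_eq]
  constructor
  · rintro ⟨⟨g, hg, rfl⟩, hO⟩
    exact ⟨g, ((orbitPGL2Equiv_gl2zOrbit_iff g f₀).mp hO).symm, rfl⟩
  · rintro ⟨g, hg, rfl⟩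
    exact ⟨⟨g, hS f₀ hf₀ g hg, rfl⟩, (orbitPGL2Equiv_gl2zOrbit_iff g f₀).mpr hg.symm⟩

/-- **`Σ_O 1/m(O) ≤ #{PGL₂(ℚ)-classes met by S} (= Σ_O 1/n(O))`** for a set `S ⊆ V_ℤ` of forms with
`Δ ≠ 0`, closed under `PGL₂(ℚ)`-equivalence and meeting finitely many `GL₂(ℤ)`-orbits; `r O ∈ O` is
any choice of representatives (the weight does not depend on it). [cite: BhargavaShankarAnnals2015, §3.2 (weighting by 1/m instead of 1/n; published numbering)] -/
theorem sum_one_div_globalWeight_le_pgl2QClassCount (S : Set (BinaryQuartic ℤ))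
    (hS : ∀ f ∈ S, ∀ g : BinaryQuartic ℤ,
      PGL2Equiv (f.map (Int.castRingHom ℚ)) (g.map (Int.castRingHom ℚ)) → g ∈ S)
    (hΔ : ∀ f ∈ S, f.disc ≠ 0) (hfin : (gl2zOrbit '' S).Finite)
    {r : Set (BinaryQuartic ℤ) → BinaryQuartic ℤ} (hr : ∀ O ∈ gl2zOrbit '' S, r O ∈ O) :
    ∑ O ∈ hfin.toFinset, (1 : ℚ) / globalWeight (r O) ≤ pgl2QClassCount S := by
  rw [pgl2QClassCount_eq_sum_one_div S hfin]
  refine Finset.sum_le_sum fun O hO ↦ ?_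
  rw [Set.Finite.mem_toFinset] at hO
  obtain ⟨f₀, hf₀, rfl⟩ := id hO
  have hrO : r (gl2zOrbit f₀) ∈ gl2zOrbit f₀ := hr _ hO
  rw [card_filter_orbitPGL2Equiv_eq_ncard_intClassOrbits S hS hfin hf₀, globalWeight_eq_of_mem_gl2zOrbit hrO,
    ncard_intClassOrbits_int]
  have hn : 1 ≤ (gl2zOrbit '' {g | PGL2Equiv (f₀.map (Int.castRingHom ℚ)) (g.map (Int.castRingHom ℚ))}).ncard := by
    rw [Nat.one_le_iff_ne_zero, Ne, Set.ncard_eq_zero (hfin.subset ?_)]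
    · exact Set.nonempty_iff_ne_empty.mp ⟨_, f₀, PGL2Equiv.refl _, rfl⟩
    · rintro _ ⟨g, hg, rfl⟩
      exact ⟨g, hS f₀ hf₀ g hg, rfl⟩
  have hm := ncard_intClassOrbits_le_globalWeight f₀ (hΔ f₀ hf₀)
  have hn' : (0 : ℚ) < (gl2zOrbit '' {g | PGL2Equiv (f₀.map (Int.castRingHom ℚ)) (g.map (Int.castRingHom ℚ))}).ncard := by
    exact_mod_cast hn
  exact one_div_le_one_div_of_le hn' (by exact_mod_cast hm)

/-- And `Σ_O 1/m(O) = #{PGL₂(ℚ)-classes met by S}` when every form of `S` has all its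
`ℚ`-automorphisms in `PGL₂(ℤ)` — e.g. when they are all trivial in `PGL₂(ℚ)`.
[cite: BhargavaShankarAnnals2015, §3.2 (published numbering)] -/
theorem sum_one_div_globalWeight_eq_pgl2QClassCount_of_stabilizer_le (S : Set (BinaryQuartic ℤ))
    (hS : ∀ f ∈ S, ∀ g : BinaryQuartic ℤ,
      PGL2Equiv (f.map (Int.castRingHom ℚ)) (g.map (Int.castRingHom ℚ)) → g ∈ S)
    (hΔ : ∀ f ∈ S, f.disc ≠ 0) (hfin : (gl2zOrbit '' S).Finite)
    (hstab : ∀ f ∈ S, stabilizer (GL (Fin 2) ℚ) (f.map (Int.castRingHom ℚ)) ≤ integralUpToScalars (Int.castRingHom ℚ))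
    {r : Set (BinaryQuartic ℤ) → BinaryQuartic ℤ} (hr : ∀ O ∈ gl2zOrbit '' S, r O ∈ O) :
    ∑ O ∈ hfin.toFinset, (1 : ℚ) / globalWeight (r O) = pgl2QClassCount S := by
  rw [pgl2QClassCount_eq_sum_one_div S hfin]
  refine Finset.sum_congr rfl fun O hO ↦ ?_
  rw [Set.Finite.mem_toFinset] at hO
  obtain ⟨f₀, hf₀, rfl⟩ := id hO
  have hrO : r (gl2zOrbit f₀) ∈ gl2zOrbit f₀ := hr _ hO
  rw [card_filter_orbitPGL2Equiv_eq_ncard_intClassOrbits S hS hfin hf₀, globalWeight_eq_of_mem_gl2zOrbit hrO,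
    ncard_intClassOrbits_int, (globalWeight_eq_ncard_iff f₀ (hΔ f₀ hf₀)).mpr fun g hg ↦ hstab g (hS f₀ hf₀ g hg)]

end BinaryQuartic

end Literature.NumberTheory.EllipticCurves

end
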